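/-
Copyright (c) 2026 the pub-hodgecm-mathlib formalisation cell (harness21).  Prover seat hodgecm-mathlib-K2E2-p12 (g5): Track B «K2-LIT», ENGINE E1,
h413 = stmt-HodgeConjecture-24833; «EIS-WHITTAKER-3» W3₃ (W-asm) sub-brick (U3C-c3-split) «THE UNIT VALUE AT A GOOD SPLIT PLACE» (dealer K2E1-plan (g5) 09:27:38Z (2)).
-/
import Summits.HodgeConjecture.HodgeConjecture.Theorems.K2E1WhittakerLocalRotationU3          -- ★ (this seat) (U3C-c2): ★ B1's token spelling (via ★ B1)
import Summits.HodgeConjecture.HodgeConjecture.Theorems.K2E1WhittakerLocalCharactersCM         -- ★ (this seat) (U3C-c1): `χ_w = ψ_{L,w} ∘ ι_w`, `continuous_charComp`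
import Summits.HodgeConjecture.HodgeConjecture.Theorems.K2E1WhittakerLocalMeanSplitU3          -- ★ B-split (K2E1-p10): `integral_whittakerSplitCell_pi_eq`
import Summits.HodgeConjecture.HodgeConjecture.Theorems.K2E1IntertwiningLocalFactorU3HeightSplit  -- ★ (this seat) (3-iii-a2): `prod_placesOver_max_one_norm_height_eq_gl3_of_split`, …
import Summits.HodgeConjecture.HodgeConjecture.Theorems.K2E1IntertwiningLocalMeanCMU3          -- ★ (this seat) (3-iii-b1): `pi_integralBox_toReal`, `ε_v = +1` ★
import Literature.NumberTheory.Automorphic.AdicCompletionResidueCard                           -- ★ `residueFieldCard_adicCompletion_eq`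
import HarnessLib

/-!
# K2·E1 — `K2E1WhittakerLocalUnitValueSplitU3` («EIS-WHITTAKER-3» W3₃, (W-asm) sub-brick (U3C-c3-split)): THE UNIT VALUE OF THE LOCAL WHITTAKER TOKEN AT A GOOD SPLIT
# PLACE — `W_v(ξ,z) = (1 − q_v^{−z})(1 − ε_v q_v^{−z})(1 − ε_v q_v^{−(2z−1)})` (`ε_v = +1`), for `ξ` a unit above `v`

Track B ∕ K2-LIT, crux h413 = `stmt-HodgeConjecture-24833`, route of record `HCCMUnconditional`; cell `hodgecm-mathlib`, squad K2, ENGINE E1 (campaign «EIS-WHITTAKER-3», rung W3₃).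
THEOREMS ONLY (no `def`, no instance, no notation, no `sorry`; default heartbeats); lane `--supports stmt-HodgeConjecture-24833 --as helper` (count-neutral).  At a split `v`
(`{w' ∣ v} = {w, w̄}`, `ι_w : L⁺_v ≅ L_w`), with `ξ_w = ι_w(a₁)`, `ξ_{w̄} = ι_{w̄}(a₂)`: `Q_v(p) = A(x,z')·B(y,z'−xy)` at `(x,y,z') = Φ(p)` ★ (3-iii-a2), and
`ψ_{L,w}(ξ·Ψ_v(p)_w)·ψ_{L,w̄}(ξ·Ψ_v(p)_{w̄}) = χ_w(x·a₁)·χ_{w̄}(y·(−a₂))` (★ `Ψ_v(a,b)_w = ι_w(a + δ_w b)`, `Ψ_v(a,b)_{w̄} = ι_{w̄}(a − δ_w b)`), so ★ B1's integrand IS ★ B-split's integrand at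
`ψ₁ = χ_w`, `ψ₂ = χ_{w̄}`, `(ξ₁, ξ₂) = (a₁, −a₂)`; ★ B-split evaluates it.
* `localWhittaker_integrand_eq_splitCell` (pointwise), **`localWhittaker_eq_unit_of_split`** (HEAD): under `hw : c•w ≠ w`, `‖δ_w‖ = ‖2‖ = 1`, `χ_w`, `χ_{w̄}` of conductor exponent `0`,
  `|a₁| = |a₂| = 1`, `1 < Re z`: `W_v(ξ,z) = (1 − q_v^{−z})(1 − ε_v q_v^{−z})(1 − ε_v q_v^{−(2z−1)})` — ★ B1's token and unit value VERBATIM (`hW` of ★ (U3C-a)∕(U3C-b) at a split `v`).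
HONEST LABEL: HC_CM is proved only modulo the 7 printed citations (2 remaining named inputs: hLiu418 = `stmt-HodgeConjecture-24832`, h413 = `stmt-HodgeConjecture-24833`) until rung 0
closes; this file asserts no named fact and closes no socket; count-neutral; unconditional.

## References
* [Rogawski1990] J. D. Rogawski, *Automorphic Representations of Unitary Groups in Three Variables* (1990): §4.5.
* [Bump1997] D. Bump, *Automorphic Forms and Representations* (1997): §3.5, Thm 3.7.2 (unramified `GL₃` Whittaker vectors).
* [CasselsFrohlichANT1967] J. W. S. Cassels, A. Fröhlich (eds.), *Algebraic Number Theory* (1967): Ch. II §10.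
-/

set_option autoImplicit false
set_option linter.dupNamespace false -- the mandated namespace repeats `HodgeConjecture.HodgeConjecture`

noncomputable section

open MeasureTheory NumberField IsDedekindDomain Filter
open scoped NNReal ENNReal
open Literature.NumberTheory.Automorphic Literature.NumberTheory.Automorphic.UnitaryGroup Literature.NumberTheory.GaloisRepresentations
open Literature.NumberTheory.GaloisRepresentations.IsNonarchimedeanLocalField
open Literature.NumberTheory.GelbartRogawski1991.UnitaryDualPair.LocalSplitting (splitSqrt)
open Summit.HodgeConjecture.HodgeConjecture.Cruxes.H413.K2E1IntertwiningLocalFactorU3Height (ne_one_of_apply_eq_neg)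
open Summit.HodgeConjecture.HodgeConjecture.Cruxes.H413.K2E1IntertwiningLocalFactorU3HeightSplit
open Summit.HodgeConjecture.HodgeConjecture.Cruxes.H413.K2E1WhittakerLocalCharactersCM (continuous_charComp charComp_apply)
open Summit.HodgeConjecture.HodgeConjecture.Cruxes.H413.K2E1WhittakerLocalMeanSplitU3 (integral_whittakerSplitCell_pi_eq)
open Summit.HodgeConjecture.HodgeConjecture.Cruxes.H413.K2E1IntertwiningLocalMeanCMU3 (pi_integralBox_toReal)
open Summit.HodgeConjecture.HodgeConjecture.Cruxes.H413.K2E1QuadraticHeckeCharCMPlaceValues (valueAtUniformizer_quadraticHeckeCharCM_of_split)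

namespace Summit.HodgeConjecture.HodgeConjecture.Cruxes.H413.K2E1WhittakerLocalUnitValueSplitU3

variable (L : Type) [Field L] [NumberField L] [IsCMField L] {δ : L} (hcδ : IsCMField.complexConj L δ = -δ) (hδ : δ ≠ 0)
  {d : ↥(maximalRealSubfield L)} (hd : δ * δ = algebraMap ↥(maximalRealSubfield L) L d) (v : HeightOneSpectrum (𝓞 ↥(maximalRealSubfield L))) (w : PlacesOver L v)

include hd in
/-- **★ B1's INTEGRAND AT A SPLIT PLACE IS ★ B-split's INTEGRAND** at `ψ₁ = χ_w`, `ψ₂ = χ_{w̄}`, `(ξ₁, ξ₂) = (a₁, −a₂)` where `ξ_w = ι_w(a₁)`, `ξ_{w̄} = ι_{w̄}(a₂)`: pointwise in `p`,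
`Q_v(p)^{−z}·∏_{w'} ψ_{L,w'}(ξ·Ψ_v(p)_{w'}) = [A(q₀,q₂)^{−z}·(B(q₁,q₂−q₀q₁)^{−z}·χ_{w̄}(q₁·(−a₂)))·χ_w(q₀·a₁)](Φ(p))`. [cite: Rogawski1990, §4.5] [cite: Bump1997, §3.5] -/
theorem localWhittaker_integrand_eq_splitCell (hw : IsCMField.complexConj L • w.1 ≠ w.1) (ξ : L) (a₁ a₂ : v.adicCompletion ↥(maximalRealSubfield L))
    (ha₁ : toPlace v w a₁ = ((ξ : L) : w.1.adicCompletion L)) (ha₂ : toPlace v (PlacesOver.galInv (IsCMField.complexConj L) w) a₂ = ((ξ : L) : (PlacesOver.galInv (IsCMField.complexConj L) w).1.adicCompletion L))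
    (z : ℂ) (p : Fin 3 → v.adicCompletion ↥(maximalRealSubfield L)) :
    ((((∏ w' : PlacesOver L v, max 1 (max ((normAbs (w'.1.adicCompletion L) (quadraticLocalEquiv L v (IsCMField.complexConj L) hcδ hδ (p 0, p 1) w') : ℝ≥0) : ℝ)
          ((normAbs (w'.1.adicCompletion L) ((toLocalRing L v (p 2) * algebraMap L (LocalRing L v) δ -
            toLocalRing L v 2⁻¹ * (quadraticLocalEquiv L v (IsCMField.complexConj L) hcδ hδ (p 0, p 1) *
              conjLocal L (IsCMField.complexConj L) v (quadraticLocalEquiv L v (IsCMField.complexConj L) hcδ hδ (p 0, p 1)))) w') : ℝ≥0) : ℝ))) : ℝ) : ℂ) ^ (-z)) *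
              (∏ w' : PlacesOver L v, (adeleAddCharAt L w'.1 (((ξ : L) : w'.1.adicCompletion L) * quadraticLocalEquiv L v (IsCMField.complexConj L) hcδ hδ (p 0, p 1) w') : ℂ)) =
      (fun q : Fin 3 → v.adicCompletion ↥(maximalRealSubfield L) => ((max 1 (max ((normAbs (v.adicCompletion ↥(maximalRealSubfield L)) (q 0) : ℝ≥0) : ℝ) ((normAbs (v.adicCompletion ↥(maximalRealSubfield L)) (q 2) : ℝ≥0) : ℝ)) : ℝ) : ℂ) ^ (-z) *
        (((max 1 (max ((normAbs (v.adicCompletion ↥(maximalRealSubfield L)) (q 1) : ℝ≥0) : ℝ) ((normAbs (v.adicCompletion ↥(maximalRealSubfield L)) (q 2 - q 0 * q 1) : ℝ≥0) : ℝ)) : ℝ) : ℂ) ^ (-z) * ((((adeleAddCharAt L (PlacesOver.galInv (IsCMField.complexConj L) w).1).compAddMonoidHom (toPlace v (PlacesOver.galInv (IsCMField.complexConj L) w) : v.adicCompletion ↥(maximalRealSubfield L) →+* (PlacesOver.galInv (IsCMField.complexConj L) w).1.adicCompletion L).toAddMonoidHom) (q 1 * -a₂) : Circle) : ℂ)) 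*
          ((((adeleAddCharAt L (w).1).compAddMonoidHom (toPlace v (w) : v.adicCompletion ↥(maximalRealSubfield L) →+* (w).1.adicCompletion L).toAddMonoidHom) (q 0 * a₁) : Circle) : ℂ))
        ![p 0 + splitSqrt ↥(maximalRealSubfield L) L (IsCMField.complexConj L) hcδ hδ v w * p 1, -(p 0 - splitSqrt ↥(maximalRealSubfield L) L (IsCMField.complexConj L) hcδ hδ v w * p 1), splitSqrt ↥(maximalRealSubfield L) L (IsCMField.complexConj L) hcδ hδ v w * p 2 - 2⁻¹ * (p 0 + splitSqrt ↥(maximalRealSubfield L) L (IsCMField.complexConj L) hcδ hδ v w * p 1) * (p 0 - splitSqrt ↥(maximalRealSubfield L) L (IsCMField.complexConj L) hcδ hδ v w * p 1)] := by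
  classical
  haveI : Algebra.IsQuadraticExtension ↥(maximalRealSubfield L) L := IsCMField.isQuadraticExtension L
  have hc1 : IsCMField.complexConj L ≠ 1 := ne_one_of_apply_eq_neg L (IsCMField.complexConj L) hcδ hδ
  have hne : PlacesOver.galInv (IsCMField.complexConj L) w ≠ w := PlacesOver.galInv_ne (IsCMField.complexConj L) w hw
  have huniv : (Finset.univ : Finset (PlacesOver L v)) = {w, PlacesOver.galInv (IsCMField.complexConj L) w} := by
    ext w'
    simp only [Finset.mem_univ, Finset.mem_insert, Finset.mem_singleton, true_iff]
    exact PlacesOver.eq_or_eq_galInv (IsCMField.complexConj L) hc1 w w'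
  have hA : 0 ≤ max 1 (max ((normAbs (v.adicCompletion ↥(maximalRealSubfield L)) (p 0 + splitSqrt ↥(maximalRealSubfield L) L (IsCMField.complexConj L) hcδ hδ v w * p 1) : ℝ≥0) : ℝ)
      ((normAbs (v.adicCompletion ↥(maximalRealSubfield L)) (splitSqrt ↥(maximalRealSubfield L) L (IsCMField.complexConj L) hcδ hδ v w * p 2 - 2⁻¹ * (p 0 + splitSqrt ↥(maximalRealSubfield L) L (IsCMField.complexConj L) hcδ hδ v w * p 1) * (p 0 - splitSqrt ↥(maximalRealSubfield L) L (IsCMField.complexConj L) hcδ hδ v w * p 1)) : ℝ≥0) : ℝ)) := le_trans zero_le_one (le_max_left _ _)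
  have hB : 0 ≤ max 1 (max ((normAbs (v.adicCompletion ↥(maximalRealSubfield L)) (-(p 0 - splitSqrt ↥(maximalRealSubfield L) L (IsCMField.complexConj L) hcδ hδ v w * p 1)) : ℝ≥0) : ℝ)
      ((normAbs (v.adicCompletion ↥(maximalRealSubfield L)) ((splitSqrt ↥(maximalRealSubfield L) L (IsCMField.complexConj L) hcδ hδ v w * p 2 - 2⁻¹ * (p 0 + splitSqrt ↥(maximalRealSubfield L) L (IsCMField.complexConj L) hcδ hδ v w * p 1) * (p 0 - splitSqrt ↥(maximalRealSubfield L) L (IsCMField.complexConj L) hcδ hδ v w * p 1)) -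
        (p 0 + splitSqrt ↥(maximalRealSubfield L) L (IsCMField.complexConj L) hcδ hδ v w * p 1) * (-(p 0 - splitSqrt ↥(maximalRealSubfield L) L (IsCMField.complexConj L) hcδ hδ v w * p 1))) : ℝ≥0) : ℝ)) := le_trans zero_le_one (le_max_left _ _)
  -- the character product over `{w, w̄}`
  have hchar : (∏ w' : PlacesOver L v, (adeleAddCharAt L w'.1 (((ξ : L) : w'.1.adicCompletion L) * quadraticLocalEquiv L v (IsCMField.complexConj L) hcδ hδ (p 0, p 1) w') : ℂ)) =
      ((((adeleAddCharAt L (w).1).compAddMonoidHom (toPlace v (w) : v.adicCompletion ↥(maximalRealSubfield L) →+* (w).1.adicCompletion L).toAddMonoidHom) ((p 0 + splitSqrt ↥(maximalRealSubfield L) L (IsCMField.complexConj L) hcδ hδ v w * p 1) * a₁) : Circle) : ℂ) *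
        ((((adeleAddCharAt L (PlacesOver.galInv (IsCMField.complexConj L) w).1).compAddMonoidHom (toPlace v (PlacesOver.galInv (IsCMField.complexConj L) w) : v.adicCompletion ↥(maximalRealSubfield L) →+* (PlacesOver.galInv (IsCMField.complexConj L) w).1.adicCompletion L).toAddMonoidHom) (-(p 0 - splitSqrt ↥(maximalRealSubfield L) L (IsCMField.complexConj L) hcδ hδ v w * p 1) * -a₂) : Circle) : ℂ) := by
    rw [huniv, Finset.prod_pair hne.symm,
      quadraticLocalEquiv_apply_eq_toPlace_of_split L (IsCMField.complexConj L) hcδ hδ hd v w hw (p 0) (p 1),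
      quadraticLocalEquiv_apply_galInv_eq_toPlace_of_split L (IsCMField.complexConj L) hcδ hδ hd v w hw (p 0) (p 1),
      ← ha₁, ← ha₂, ← map_mul, ← map_mul, charComp_apply, charComp_apply, mul_comm a₁,
      show a₂ * (p 0 - splitSqrt ↥(maximalRealSubfield L) L (IsCMField.complexConj L) hcδ hδ v w * p 1) = -(p 0 - splitSqrt ↥(maximalRealSubfield L) L (IsCMField.complexConj L) hcδ hδ v w * p 1) * -a₂ by ring]
  rw [hchar, prod_placesOver_max_one_norm_height_eq_gl3_of_split L (IsCMField.complexConj L) hcδ hδ hd v w hw (p 0) (p 1) (p 2), Complex.ofReal_mul,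
    Complex.mul_cpow_ofReal_nonneg hA hB]
  simp only [Matrix.cons_val_zero, Matrix.cons_val_one, Matrix.cons_val_two, Matrix.head_cons, Matrix.tail_cons]
  ring

variable [MeasurableSpace (v.adicCompletion ↥(maximalRealSubfield L))] [BorelSpace (v.adicCompletion ↥(maximalRealSubfield L))] (νv : Measure (v.adicCompletion ↥(maximalRealSubfield L))) [νv.IsAddHaarMeasure]

include hd in
/-- **THE UNIT VALUE OF THE LOCAL WHITTAKER TOKEN AT A GOOD SPLIT PLACE** (`ε_v = +1` ★): for `w ∣ v` split, `‖δ_w‖ = ‖2‖ = 1`, `χ_w` and `χ_{w̄}` of conductor exponent `0`,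
`ξ_w = ι_w(a₁)`, `ξ_{w̄} = ι_{w̄}(a₂)` with `|a₁| = |a₂| = 1`, and `1 < Re z`: `W_v(ξ,z) = (1 − q_v^{−z})(1 − ε_v q_v^{−z})(1 − ε_v q_v^{−(2z−1)})` — ★ B1's token and unit value
VERBATIM (★ B-split at `ψ₁ = χ_w`, `ψ₂ = χ_{w̄}`, `(ξ₁, ξ₂) = (a₁, −a₂)`, `m₁ = m₂ = 0`; `ν_v(𝒪_v³) = ν_v(𝒪_v)³` ★; `ε_v = +1` ★). [cite: Rogawski1990, §4.5] [cite: Bump1997, Thm 3.7.2] -/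
theorem localWhittaker_eq_unit_of_split (hw : IsCMField.complexConj L • w.1 ≠ w.1) (hδ1 : normAbs (v.adicCompletion ↥(maximalRealSubfield L)) (splitSqrt ↥(maximalRealSubfield L) L (IsCMField.complexConj L) hcδ hδ v w) = 1) (h2 : normAbs (v.adicCompletion ↥(maximalRealSubfield L)) (2 : v.adicCompletion ↥(maximalRealSubfield L)) = 1)
    (hχ₁ : ((adeleAddCharAt L (w).1).compAddMonoidHom (toPlace v (w) : v.adicCompletion ↥(maximalRealSubfield L) →+* (w).1.adicCompletion L).toAddMonoidHom).HasConductorExp 0)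
    (hχ₂ : ((adeleAddCharAt L (PlacesOver.galInv (IsCMField.complexConj L) w).1).compAddMonoidHom (toPlace v (PlacesOver.galInv (IsCMField.complexConj L) w) : v.adicCompletion ↥(maximalRealSubfield L) →+* (PlacesOver.galInv (IsCMField.complexConj L) w).1.adicCompletion L).toAddMonoidHom).HasConductorExp 0)
    (ξ : L) (a₁ a₂ : v.adicCompletion ↥(maximalRealSubfield L)) (ha₁ : toPlace v w a₁ = ((ξ : L) : w.1.adicCompletion L))
    (ha₂ : toPlace v (PlacesOver.galInv (IsCMField.complexConj L) w) a₂ = ((ξ : L) : (PlacesOver.galInv (IsCMField.complexConj L) w).1.adicCompletion L))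
    (hu₁ : Valued.v a₁ = 1) (hu₂ : Valued.v a₂ = 1) {z : ℂ} (hz : 1 < z.re) :
    ((Measure.pi fun _ : Fin 3 => νv) (integralBox ↥(maximalRealSubfield L) (Fin 3) v)).toReal⁻¹ •
          ∫ p : Fin 3 → v.adicCompletion ↥(maximalRealSubfield L),
            ((((∏ w' : PlacesOver L v, max 1 (max ((normAbs (w'.1.adicCompletion L) (quadraticLocalEquiv L v (IsCMField.complexConj L) hcδ hδ (p 0, p 1) w') : ℝ≥0) : ℝ)
          ((normAbs (w'.1.adicCompletion L) ((toLocalRing L v (p 2) * algebraMap L (LocalRing L v) δ -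
            toLocalRing L v 2⁻¹ * (quadraticLocalEquiv L v (IsCMField.complexConj L) hcδ hδ (p 0, p 1) *
              conjLocal L (IsCMField.complexConj L) v (quadraticLocalEquiv L v (IsCMField.complexConj L) hcδ hδ (p 0, p 1)))) w') : ℝ≥0) : ℝ))) : ℝ) : ℂ) ^ (-z)) *
              (∏ w' : PlacesOver L v, (adeleAddCharAt L w'.1 (((ξ : L) : w'.1.adicCompletion L) * quadraticLocalEquiv L v (IsCMField.complexConj L) hcδ hδ (p 0, p 1) w') : ℂ))
            ∂(Measure.pi fun _ : Fin 3 => νv) =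
      (1 - (v.residueCard : ℂ) ^ (-z)) * (1 - (quadraticHeckeCharCM L).valueAtUniformizer v * (v.residueCard : ℂ) ^ (-z)) *
        (1 - (quadraticHeckeCharCM L).valueAtUniformizer v * (v.residueCard : ℂ) ^ (-(2 * z - 1))) := by
  rw [integral_congr_ae (Filter.Eventually.of_forall (localWhittaker_integrand_eq_splitCell L hcδ hδ hd v w hw ξ a₁ a₂ ha₁ ha₂ z))]
  have hmem : ∀ x : v.adicCompletion ↥(maximalRealSubfield L), Valued.v x = 1 → x ∈ primePowBall (v.adicCompletion ↥(maximalRealSubfield L)) 0 ∧ x ∉ primePowBall (v.adicCompletion ↥(maximalRealSubfield L)) (0 + 1) :=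
    fun x hx => ⟨(mem_primePowBall_adicCompletion_iff v).2 (by rw [hx, neg_zero, WithZero.exp_zero]),
      fun h => by
        have h' := (mem_primePowBall_adicCompletion_iff v).1 h
        rw [hx, zero_add, ← WithZero.exp_zero, WithZero.exp_le_exp] at h'
        exact absurd h' (by norm_num)⟩
  have hu₂' : Valued.v (-a₂) = 1 := by rw [Valuation.map_neg, hu₂]
  rw [integral_whittakerSplitCell_pi_eq νv hδ1 h2 (continuous_charComp L v w) (continuous_charComp L v (PlacesOver.galInv (IsCMField.complexConj L) w)) hχ₁ hχ₂
      (hmem _ hu₁).1 (hmem _ hu₁).2 (hmem _ hu₂').1 (hmem _ hu₂').2 hz,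
    pi_integralBox_toReal L v νv, residueFieldCard_adicCompletion_eq, valueAtUniformizer_quadraticHeckeCharCM_of_split L v w hw, Complex.real_smul,
    ← mul_assoc, Complex.ofReal_inv, Complex.ofReal_pow, inv_mul_cancel₀ (pow_ne_zero 3 (by exact_mod_cast (LocalFieldHaar.measureReal_primePowBall_pos νv 0).ne')),
    one_mul]
  ring

end Summit.HodgeConjecture.HodgeConjecture.Cruxes.H413.K2E1WhittakerLocalUnitValueSplitU3

end
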